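import Summits.QuantumFields.YangMills.Theorems.BalabanUVNodesPortS1FEPolyTorus
import Literature.Probability.LatticeModels.PolymerPressureAnalytic

/-!
# PT-S1 ∕ ⟨27930⟩ — S₄ `FEPolymerResummation` HOLDS: analyticity of the resummed pieces on `U^c_{k+1}(X, α₀, α₁)` and ★★★ `fePolymerResummation_holds : ∀ F, FEPolymerResummation F`
# (the KP resummation [II] (2.12)–(2.13), (2.39)–(2.41) at the record, antecedent-free, over the tree's PROVED Kotecký–Preiss engine)

Cell `ym-nodeO-ideate` ∕ `ym-balaban-port`, DEFINER seat `ym-nodeO-def-1` (gen 39), S₄ assigned by ★★★ director-ym №638 (2) (nodeO STATUS 2026-08-31 l.6180; plan l.6197; ◆ plan cut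
l.6247); `--kind proof --supports stmt-QuantumFields-27930` (the main theorem has EXACTLY the type of the v3.8 stub `stub_FEpolymerResummation`); count-neutral.
[I] = [Balaban1987RG1], [II] = [Balaban1988RG2Cluster], [KP] = [KoteckyPreiss1986].

WHAT THIS FILE IS.
* §8 ANALYTICITY (row (a)): `E(X)(ψ) = Σ_C Σ_{B ⊆ C} ± log Ξ(B; H(·)(ψ))` is a finite combination of Kotecký–Preiss logarithms of sub-families of polymers `Z ⊆ X`, whose activities are
  analytic at every `φ ∈ U^c_{k+1}(X, α₀, α₁)` (S₃'s hereditary row); on an open `U ∋ φ` where they stay analytic (`AnalyticAt.eventually_analyticAt`, finitely many) and strictly below the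
  KP threshold `A′ e^{−R d(Z)}`, `A′ := 1∕(e·K₀·9·64)` (at `φ`: `A < A′` since `A e^{5κ+1} K₀ 9·64 ≤ 1` and `κ ≥ 4κ₀ > 0`), every ray partition function `Z(B; u·H)`, `u ∈ [0,1]`, is non-zero
  ([KP] zero-freeness, lit `polymerPartitionFunction_ne_zero_of_kp` + `isKPVolume_torus_of_decay` at `τ = 1∕64`), so lit `differentiableOn_polymerLogZ_param` + Osgood
  (lit `SCV.analyticAt_of_differentiableOn`) give `analyticAt_feLocE`, `analyticAt_fePieceT`.
* §9 ★★★ `fePolymerResummation_holds` (and the registered stub name ★★★ `stub_FEpolymerResummation` of line `pta_residueW` v3.8, same statement): `Ψ := feResumInt Hi` (leaf (B+C)), `Ew := fePieceT F Mc k Hi Hw`; rows (a)(b) off the wrap class through ★★★`feResumInt_piece_eq_fePieceT`, (a)–(d) on it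
  from leaf (A) §7 + §8, (f′)-Reg from S₃'s identity `Φ = log Ξ(B) − log Ξ(0)` on the class + ★★`sum_fePieceT_pairCutTorusAt` (KP at the cut pairs via `hnest`∕`h0`) + `pairCutAt = pullPair ∘
  pairCutTorusAt` (`rfl`); the unit pair lies in every `U^c(X)` because it is the cut pair of the ε₀-regular datum `0`.

HONEST FRAMING.  This CLOSES the candidate letter S₄ of the №634 sub-split — an antecedent-free resummation statement over the tree's proved [KP] theorem; it is NOT a Bałaban estimate:
the activities' analyticity∕decay (S₃ `FEPolymerActivitiesReg`, XXL — the wall), the chart law (S₁), the nesting (S₂) and `FEStepReg` remain OPEN and inhabited nowhere; `stub_P0C` ∕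
`stub_LZhalfReg` OPEN; ⟨27930⟩ OPEN; K0ᴬ ∕ K1ᴬ ∕ K3ᴬ OPEN; NODE O 0∕1; COUNT 8∕28 · K 1∕4 UNMOVED; finite `𝕋⁴_{L^K}` at fixed ε — NOT continuum ∕ ℝ⁴ ∕ OS; **the Yang–Mills mass gap (Clay)
is NOT proved by any of this.**  No `sorry`, `instance`, `notation`; standard axioms.
-/

noncomputable section

open scoped BigOperators Matrix.Norms.L2Operator Topology

namespace Summit.QuantumFields.YangMills.Theorems.BalabanUVNodesPortS1

open Summit.QuantumFields.YangMills.Theorems.K0RecordFormatNames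
open Literature.MathematicalPhysics.QuantumFieldTheory.Balaban1983to89
open Literature.MathematicalPhysics.QuantumFieldTheory.Balaban1983to89.Node00
open Literature.MathematicalPhysics.QuantumFieldTheory.Balaban1983to89.T4Continuum (T4Family)
open Literature.MathematicalPhysics.QuantumFieldTheory.Balaban1983to89.TreeLengthTorus (TPt IsTDom TDom torusTreeLen)
open Literature.MathematicalPhysics.QuantumFieldTheory.Balaban1983to89.TreeLengthTorusGeometry (TTouch ttouch_refl ttouch_symm)
open Literature.MathematicalPhysics.QuantumFieldTheory.Balaban1983to89.B12TreeDecay (kappa₀ K₀ K₀_pos kappa₀_nonneg)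
open Literature.MathematicalPhysics.QuantumFieldTheory.Balaban1983to89.B13Resummation (locE)
open Literature.MathematicalPhysics.QuantumFieldTheory.Balaban1983to89.B13FamilySum (coveringFamilies mem_coveringFamilies)
open Literature.MathematicalPhysics.QuantumFieldTheory.Balaban1983to89.B14.Eq347Torus (isKPVolume_torus_of_decay)
open Literature.Probability.LatticeModels (IsKPVolume polymerLogZ truncatedWeight polymerPartitionFunction polymerPartitionFunction_congr
  polymerPartitionFunction_ne_zero_of_kp differentiableOn_polymerLogZ_param)
open _root_.Filter

/-! ## §8  Row (a): analyticity of the localised parts and of the torus pieces -/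

section Analytic

variable {F : T4Family}

open scoped Classical in
/-- ★ **ROW (a) FOR THE LOCALISED PARTS**: `ψ ↦ E(X)(ψ)` is analytic at every `φ ∈ U^c_{k+1}(X, α₀, α₁)` — a finite combination of Kotecký–Preiss logarithms `log Ξ(B; H(·)(ψ))` of sub-families
`B` of polymers `Z ⊆ X`, each complex-differentiable on an open `U ∋ φ` where the activities are analytic and the ray partition functions do not vanish ([KP] zero-freeness below the threshold
`A′ = 1∕(e·K₀·9·64) > A`), then Osgood. [cite: KoteckyPreiss1986, Theorem p.492 (zero-freeness, analyticity p.493); Balaban1988RG2Cluster, (2.13) p.14, p.15 L4–11; Balaban1987RG1, (1.18) p.263] -/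
theorem analyticAt_feLocE {Mc k : ℕ} {Hi : IntLocalFormula (F.L ^ (k + 1) * Mc)} {Hw : TorusPieces F Mc k} {α₀ α₁ A R κ : ℝ}
    (hrows : ActivityRowsW F Mc k Hi Hw α₀ α₁ A R) (hA : 0 ≤ A)
    (hκ : 4 * kappa₀ (4 * 2 ^ 4) (2 * 4) ≤ κ) (hR : κ + 2 * kappa₀ (4 * 2 ^ 4) (2 * 4) + 2 ≤ R)
    (hsm : A * Real.exp (5 * κ + 1) * K₀ (4 * 2 ^ 4) (2 * 4) * 9 * 64 ≤ 1)
    (n : ℕ) (X : (recordDomSys F Mc k (recordK₀ F Mc k + n)).Dom) {φ : Sect2.CPair (F.P (recordK₀ F Mc k + n)) (MatA 2)}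
    (hφ : encodeCfg F (recordK₀ F Mc k + n) φ ∈ recordUc F Mc k α₀ α₁ (recordK₀ F Mc k + n) X) :
    AnalyticAt ℂ (fun ψ => feLocE F Mc k Hi Hw n X ψ) φ := by
  haveI : Std.Refl (TTouch (d := (F.P (recordK₀ F Mc k + n)).d) (N := Sect2.domCount (F.P (recordK₀ F Mc k + n)) Mc (k + 1))) := ⟨ttouch_refl⟩
  haveI : Std.Symm (TTouch (d := (F.P (recordK₀ F Mc k + n)).d) (N := Sect2.domCount (F.P (recordK₀ F Mc k + n)) Mc (k + 1))) := ⟨ttouch_symm⟩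
  have hκ₀ : 0 ≤ kappa₀ (4 * 2 ^ 4) (2 * 4) := kappa₀_nonneg (by norm_num) _
  have hK₀ : 0 < K₀ (4 * 2 ^ 4) (2 * 4) := K₀_pos _ _
  -- `κ₀(64, 8) > 0`, so S₄'s `κ ≥ 4κ₀` is positive: the strict room below the Kotecký–Preiss threshold
  have hκ₀pos : 0 < kappa₀ (4 * 2 ^ 4) (2 * 4) := by
    unfold kappa₀ B12TreeDecay.a₀
    refine mul_pos (by norm_num) (Real.log_pos ?_)
    push_cast
    norm_num
  have hκpos : 0 < κ := lt_of_lt_of_le (by linarith) hκ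
  -- the sub-polymers of `X`
  set S : Finset (recordDomSys F Mc k (recordK₀ F Mc k + n)).Dom := Finset.univ.filter fun Z => (Z.1 : Finset _) ⊆ X.1 with hS
  have hSmem : ∀ Z, Z ∈ S ↔ (Z.1 : Finset _) ⊆ X.1 := fun Z => by simp [hS]
  -- the threshold `A′` and the strict room `A < A′`
  have hD : 0 < Real.exp 1 * K₀ (4 * 2 ^ 4) (2 * 4) * 9 * 64 := by positivity
  set A' : ℝ := 1 / (Real.exp 1 * K₀ (4 * 2 ^ 4) (2 * 4) * 9 * 64) with hA'
  have hA'pos : 0 < A' := by positivity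
  have hAA' : A < A' := by
    have h1 : A * Real.exp (5 * κ) ≤ A' := by
      rw [hA', le_div_iff₀ hD]
      calc A * Real.exp (5 * κ) * (Real.exp 1 * K₀ (4 * 2 ^ 4) (2 * 4) * 9 * 64)
          = A * Real.exp (5 * κ + 1) * K₀ (4 * 2 ^ 4) (2 * 4) * 9 * 64 := by rw [Real.exp_add]; ring
        _ ≤ 1 := hsm
    rcases eq_or_lt_of_le hA with hA0 | hApos
    · rw [← hA0]; exact hA'pos
    · have hexp : (1 : ℝ) < Real.exp (5 * κ) := by
        have h := Real.add_one_lt_exp (x := 5 * κ) (by positivity)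
        linarith
      exact lt_of_lt_of_le (lt_mul_of_one_lt_right hApos hexp) h1
  -- an open neighbourhood of `φ` where every activity of a sub-polymer is analytic and strictly below the threshold
  have E1 : ∀ᶠ ψ in 𝓝 φ, ∀ Z ∈ S, AnalyticAt ℂ (feActAt F Mc k Hi Hw n Z) ψ :=
    (Finset.eventually_all S).2 fun Z hZ => (hrows n X Z ((hSmem Z).1 hZ) φ hφ).1.eventually_analyticAt
  have E2 : ∀ᶠ ψ in 𝓝 φ, ∀ Z ∈ S, ‖feActAt F Mc k Hi Hw n Z ψ‖ < A' * Real.exp (-(R * (recordDomSys F Mc k (recordK₀ F Mc k + n)).dj Z)) :=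
    (Finset.eventually_all S).2 fun Z hZ => by
      have h := hrows n X Z ((hSmem Z).1 hZ) φ hφ
      have hlt : ‖feActAt F Mc k Hi Hw n Z φ‖ < A' * Real.exp (-(R * (recordDomSys F Mc k (recordK₀ F Mc k + n)).dj Z)) :=
        lt_of_le_of_lt h.2 (mul_lt_mul_of_pos_right hAA' (Real.exp_pos _))
      exact h.1.continuousAt.norm.eventually_lt continuousAt_const hlt
  obtain ⟨U, hUsub, hUo, hφU⟩ := mem_nhds_iff.1 (E1.and E2)
  -- [KP] zero-freeness of the ray partition functions of families inside `S`, on `U`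
  have hZne : ∀ B : Finset (recordDomSys F Mc k (recordK₀ F Mc k + n)).Dom, B ⊆ S → ∀ z ∈ U, ∀ u ∈ Set.Icc (0 : ℝ) 1,
      polymerPartitionFunction TTouch (fun γ => (u : ℂ) * feActAt F Mc k Hi Hw n γ z) B ≠ 0 := by
    intro B hBS z hz u hu
    obtain ⟨-, h2z⟩ := hUsub hz
    set H : (recordDomSys F Mc k (recordK₀ F Mc k + n)).Dom → ℂ := fun Z => if Z ∈ S then (u : ℂ) * feActAt F Mc k Hi Hw n Z z else 0 with hH
    have hHb : ∀ Z : (recordDomSys F Mc k (recordK₀ F Mc k + n)).Dom, ‖H Z‖ ≤ A' * Real.exp (-(R * torusTreeLen Z.1)) := by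
      intro Z
      by_cases hZ : Z ∈ S
      · have hu1 : ‖(u : ℂ)‖ ≤ 1 := by rw [Complex.norm_real, Real.norm_eq_abs, abs_of_nonneg hu.1]; exact hu.2
        simp only [hH, hZ, if_true, norm_mul]
        calc ‖(u : ℂ)‖ * ‖feActAt F Mc k Hi Hw n Z z‖ ≤ 1 * ‖feActAt F Mc k Hi Hw n Z z‖ := mul_le_mul_of_nonneg_right hu1 (norm_nonneg _)
          _ ≤ A' * Real.exp (-(R * torusTreeLen Z.1)) := by rw [one_mul]; exact (h2z Z hZ).le
      · simp only [hH, hZ, if_false, norm_zero]; positivity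
    have h64 : (1 / 64 : ℝ) * (4 * 2 ^ 4) = 1 := by norm_num
    have hrate : kappa₀ (4 * 2 ^ 4) (2 * 4) + 1 / 64 * (4 * 2 ^ 4) ≤ R := by rw [h64]; linarith
    have hsmall : A' * Real.exp (1 / 64 * (4 * 2 ^ 4)) * K₀ (4 * 2 ^ 4) (2 * 4) * (2 * ((4 : ℕ) : ℝ) + 1) ≤ 1 / 64 := by
      rw [h64, hA']
      have hne : Real.exp 1 * K₀ (4 * 2 ^ 4) (2 * 4) * 9 * 64 ≠ 0 := hD.ne'
      apply le_of_eq
      field_simp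
      try norm_num
      try ring
    have hKP : IsKPVolume TTouch H (fun Z : (recordDomSys F Mc k (recordK₀ F Mc k + n)).Dom => (1 / 64 : ℝ) * (Z.1.card : ℝ)) Finset.univ :=
      isKPVolume_torus_of_decay (d := 4) hA'pos.le (by norm_num) hHb hrate hsmall
    have hne := polymerPartitionFunction_ne_zero_of_kp hKP (Finset.subset_univ B)
    have hcongr : polymerPartitionFunction TTouch H B = polymerPartitionFunction TTouch (fun γ => (u : ℂ) * feActAt F Mc k Hi Hw n γ z) B :=
      polymerPartitionFunction_congr fun γ hγ => by simp only [hH, if_pos (hBS hγ)]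
    rwa [hcongr] at hne
  -- each Kotecký–Preiss logarithm of a family inside `S` is analytic at `φ`
  have hlog : ∀ B : Finset (recordDomSys F Mc k (recordK₀ F Mc k + n)).Dom, B ⊆ S →
      AnalyticAt ℂ (fun ψ => polymerLogZ TTouch (fun Z => feActAt F Mc k Hi Hw n Z ψ) B) φ := by
    intro B hBS
    have hdiff := differentiableOn_polymerLogZ_param (inc := TTouch) (v := fun ψ Z => feActAt F Mc k Hi Hw n Z ψ) B hUo
      (fun γ hγ z hz => ((hUsub hz).1 γ (hBS hγ)).differentiableAt.differentiableWithinAt) (fun z hz u hu => hZne B hBS z hz u hu)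
    exact Literature.Analysis.Complex.SCV.analyticAt_of_differentiableOn hdiff hUo hφU
  -- `E(X)` is the finite combination
  show AnalyticAt ℂ (fun ψ => ∑ C ∈ coveringFamilies (Finset.univ : Finset (recordDomSys F Mc k (recordK₀ F Mc k + n)).Dom) (fun Z => (Z.1 : Finset _)) X.1,
    ∑ B ∈ C.powerset, (-1 : ℂ) ^ (C \ B).card * polymerLogZ TTouch (fun Z => feActAt F Mc k Hi Hw n Z ψ) B) φ
  refine Finset.analyticAt_fun_sum _ fun C hC => Finset.analyticAt_fun_sum _ fun B hB => analyticAt_const.mul (hlog B ?_)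
  obtain ⟨-, hU⟩ := mem_coveringFamilies.1 hC
  intro Z hZ
  rw [hSmem, ← hU]
  exact Finset.subset_biUnion_of_mem _ (Finset.mem_powerset.1 hB hZ)

open scoped Classical in
/-- ★ **ROW (a) FOR THE TORUS PIECES**: `fePieceT n X` is analytic at every `φ ∈ U^c_{k+1}(X, α₀, α₁)`. [cite: Balaban1987RG1, (1.18) p.263, p.263 («analytic on U^c_j»); Balaban1988RG2Cluster, p.15 L4–11] -/
theorem analyticAt_fePieceT {Mc k : ℕ} {Hi : IntLocalFormula (F.L ^ (k + 1) * Mc)} {Hw : TorusPieces F Mc k} {α₀ α₁ A R κ : ℝ}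
    (hrows : ActivityRowsW F Mc k Hi Hw α₀ α₁ A R) (hA : 0 ≤ A)
    (hκ : 4 * kappa₀ (4 * 2 ^ 4) (2 * 4) ≤ κ) (hR : κ + 2 * kappa₀ (4 * 2 ^ 4) (2 * 4) + 2 ≤ R)
    (hsm : A * Real.exp (5 * κ + 1) * K₀ (4 * 2 ^ 4) (2 * 4) * 9 * 64 ≤ 1)
    (n : ℕ) (X : (recordDomSys F Mc k (recordK₀ F Mc k + n)).Dom) {φ : Sect2.CPair (F.P (recordK₀ F Mc k + n)) (MatA 2)}
    (hφ : encodeCfg F (recordK₀ F Mc k + n) φ ∈ recordUc F Mc k α₀ α₁ (recordK₀ F Mc k + n) X) :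
    AnalyticAt ℂ (fePieceT F Mc k Hi Hw n X) φ := by
  show AnalyticAt ℂ (fun ψ => feLocE F Mc k Hi Hw n X ψ - feLocE F Mc k Hi Hw n X (unitCPair F (recordK₀ F Mc k + n))) φ
  exact (analyticAt_feLocE hrows hA hκ hR hsm n X hφ).sub analyticAt_const

end Analytic

/-! ## §9  ★★★ S₄ holds -/

/-- ★★★ **S₄ `FEPolymerResummation` HOLDS** — the Kotecký–Preiss resummation at the record ([II] (2.12)–(2.13), (2.39)–(2.41)): for every admissible cube size, a W-format activity system with the
Π-rep rows at `(A, R)`, S₄'s numerics, the class nesting and the ε₀-regularity of `B = 0` give ONE integer-local formula `Ψ := feResumInt Hi` + wrap pieces `Ew := fePieceT` with the seven rows of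
`ResidueOnRegAtW` at `(E₂, κ)` for `Φ`.  EXACTLY the type of the v3.8 stub `stub_FEpolymerResummation`.  Antecedent-free bookkeeping over the tree's PROVED [KP] theorem; S₁∕S₂∕S₃∕`FEStepReg`
stay OPEN. [cite: Balaban1988RG2Cluster, (2.12)–(2.13) p.14, (2.39)–(2.41) p.21; Balaban1987RG1, (1.7) p.261, (1.18)–(1.19) p.263, (2.12)–(2.14) p.268; KoteckyPreiss1986, Theorem p.492] -/
theorem fePolymerResummation_holds : ∀ F, FEPolymerResummation F := by
  intro F Mc k a₀ ε₂₉ α₀ α₁ ε₀ A R E₂ κ Hi Hw Φf hG hA hκ hR hsm hAE hnest h0 hrep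
  obtain ⟨hrows, hloc, hGI, hid⟩ := hrep
  -- the unit pair lies in every record space: it is the cut pair of the ε₀-regular datum `B = 0`
  have hunit : ∀ (n : ℕ) (X : (recordDomSys F Mc k (recordK₀ F Mc k + n)).Dom),
      encodeCfg F (recordK₀ F Mc k + n) (unitCPair F (recordK₀ F Mc k + n)) ∈ recordUc F Mc k α₀ α₁ (recordK₀ F Mc k + n) X := fun n X => by
    have h := hnest n _ (h0 n) X
    rwa [pairCutTorusAt_zero] at h
  refine ⟨feResumInt Hi, fePieceT F Mc k Hi Hw, ?_, ?_, ?_, ?_, ?_, ?_, ?_⟩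
  · -- (a) off the wrap class, through the transport
    intro n X hX φ hφ
    have hfun : (fun ψ => (feResumInt Hi).Ψ.piece F Mc k (recordK₀ F Mc k + n) X ψ) = fePieceT F Mc k Hi Hw n X :=
      funext fun ψ => feResumInt_piece_eq_fePieceT F Hi Hw n X hX ψ
    rw [hfun]
    exact analyticAt_fePieceT hrows hA hκ hR hsm n X hφ
  · -- (b) off the wrap class
    intro n X hX φ hφ
    rw [feResumInt_piece_eq_fePieceT F Hi Hw n X hX φ]
    exact norm_fePieceT_le hrows hA hκ hR hsm hAE n X hφ (hunit n X)
  · -- (a) on the wrap class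
    intro n X _ φ hφ
    exact analyticAt_fePieceT hrows hA hκ hR hsm n X hφ
  · -- (b) on the wrap class
    intro n X _ φ hφ
    exact norm_fePieceT_le hrows hA hκ hR hsm hAE n X hφ (hunit n X)
  · -- (c) locality
    intro n X _ φ ψ h
    exact fePieceT_congr_of_agreeOnSet hG hloc n X h
  · -- (d) invariance
    intro n X _ u φ
    exact fePieceT_cAct hGI n X u φ
  · -- (f′) on the ε₀-class
    intro n B hB
    rw [hid n B hB, ← sum_fePieceT_pairCutTorusAt hG hloc hrows hA hκ hR hsm (hnest n B hB) (hnest n _ (h0 n))]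
    refine Finset.sum_congr rfl fun X _ => ?_
    split_ifs with hX
    · rfl
    · rw [← feResumInt_piece_eq_fePieceT F Hi Hw n X hX]
      rfl

/-- ★★★ **`stub_FEpolymerResummation` — THE REGISTERED STUB OF LINE `pta_residueW` (v3.8), BY NAME AND SIGNATURE**: `∀ F, FEPolymerResummation F` is ✓`fePolymerResummation_holds`.
[cite: Balaban1988RG2Cluster, (2.12)–(2.13) p.14, (2.39)–(2.41) p.21; KoteckyPreiss1986, Theorem p.492] -/
theorem stub_FEpolymerResummation : ∀ F, Summit.QuantumFields.YangMills.Theorems.BalabanUVNodesPortS1.FEPolymerResummation F :=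
  fePolymerResummation_holds

end Summit.QuantumFields.YangMills.Theorems.BalabanUVNodesPortS1

end
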